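import Summits.QuantumFields.YangMills.Theorems.UnitScaleTiltProp7TransverseRowOfTubeRowRegPr
import Summits.QuantumFields.YangMills.Theorems.UnitScaleTiltProp7QTwSEllTwoBound
import HarnessLib

/-!
# Route `UnitScaleTilt`, crux K1 «MinimiserStabilityRegPr» (stmt-QuantumFields-19200), EX face — one-form VALUE book, pen (P-Q†):
# **THE SUP ROW OF `Q_k(U₀)†` AT A CURVED BACKGROUND, CLOSED MODULO ONE DISPLAYED ENTRYWISE LETTER (COL) OF THE AVERAGING OPERATOR OF RECORD,
# AND THE `Q_k†(a•Q_k)` ROW (the (Q) letter of the one-form Kato bootstrap O2)**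

Cell `ym3-torus` (HUMAN RULING D-0037; rung R3 = SU(2) YM₃ on T³ — NOT d = 4, NOT infinite volume, NOT a mass gap, NOT Clay).  Width seat `ym3-torus-px17` (gen 10),
★p1 g26 CHAIR WORD №4 (B) pen (P-Q†); LOCATE `ym3-torus-px17/g10/LOCATE-PQdagger-px17g10.md` (19200 evidence #55).  THEOREMS ONLY (0 `def`, 0 `sorry`, default heartbeats);
`--supports stmt-QuantumFields-19200 --as helper`; count-neutral.

THE POINT (the LOCATE's §1∕§4).  `Q_k(U₀) = η • toL2B ∘ QTwS U₀ ∘ toL2⁻¹` (✓`Prop7SectET3CurvedPropagators.Qk`, ✓`Prop7TransverseRowOfTubeRowRegPr.Qk_toL2`), so by the two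
printed pairings (✓`inner_toL2` (3.11), ✓`inner_toL2B` (3.16)) the readback `Z := toL2⁻¹(Q_k(U₀)†(toL2B Y))` of the Hilbert adjoint is the `(η·cB∕c₀)`-weighted TRANSPOSE of
`QTwS U₀` tested against `Y`: `⟪toL2(δ_b ⊗ X), Q_k(U₀)†(toL2B Y)⟫ = η·cB·Σ_c tr((QTwS U₀ (δ_b ⊗ X))(c)ᴴ·Y(c))` (§1).  Hence the SUP ROW of `Q_k(U₀)†` follows from ONE entrywise
letter of the averaging operator of record — the column `ℓ¹` bound on a one-bond spike
  (COL)  `Σ_c ‖(QTwS U₀ (δ_b ⊗ X))(c)‖ ≤ C_Q·((L:ℝ)^(K−n))⁻²·‖X‖`   (FLAT: `C_Q = 1` by ✓`QTwS_one_apply`, the tent count of ✓`Prop7QkAdjointFlatKernel`),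
displayed here as a hypothesis (§2 ★ `norm_toL2_symm_adjoint_Qk_apply_le_of_col`: `‖Z(b)‖ ≤ 2C_Q·(cB∕c₀)·((L:ℝ)^(K−n))⁻³·‖Y‖`), exactly as V6 displays its gradient-column
letter `hDcol`.  §3 adds the `ℓ²` operator bound of `Q_k(U₀)` at a printed-regular background from ✓`Prop7QTwSEllTwoBound.sum_normSq_entries_QTwS_le`
(`‖Q_k(U₀)u‖ ≤ 6√(cB∕c₀)·√(((L:ℝ)^(K−n))⁻³)·‖u‖`) and §4 the (Q) letter of O2: ★★ `norm_equiv_adjoint_Qk_smul_Qk_apply_le_of_col` — the pointwise row of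
`Q_k(U₀)†((a:ℂ)•Q_k(U₀)u)` with constant `a·√2·(2C_Q(cB∕c₀)ℓ⁻³)·(N_Q∕√cB)·‖u‖` for any operator bound `N_Q`, and its `RegPr` edition with `N_Q := 6√(cB∕c₀)√(ℓ⁻³)`.
WHY (COL) IS DISPLAYED AND NOT PROVED (LOCATE §2–§3): the tree controls `QTwS U₀` at `U₀ ≠ 1` in `ℓ² → ℓ²` only, which on a spike loses `ℓ^{3∕2}` against the tent count;
the entrywise row is new analysis (the `ℓ¹ → ℓ^∞` twin of ✓`Prop7TrueLinIterDefect`).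

HONEST SCOPE.  Linear-algebra bookkeeping (duality in two finite-dimensional Hilbert spaces, Frobenius vs operator norms on `M₂(ℂ)`) over landed letters; (COL) is a
HYPOTHESIS; nothing of O2, the ten print rows, `hT`, EX or the crux is proved; no stub ∕ crux ∕ summit statement is proved or claimed.

References: T. Bałaban, CMP **99** (1985) 389–434 [Balaban1985BackgroundPropagators] (p.391, (3.11) p.392, (3.13)–(3.16) p.393, (3.26) p.395, Thm 3.11 p.416, (3.42) p.397);
CMP **95** (1984) 17–40 [Balaban1984PropagatorsI] ((1.18) p.20, (1.21) p.21); CMP **98** (1985) 17–51 [Balaban1985Averaging] ((18)–(20) p.21);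
CMP **102** (1985) 277–309 [Balaban1985Variational] ((44)–(45) p.285, (137) p.298, (138)–(139) p.299).
-/

set_option autoImplicit false

noncomputable section

open scoped InnerProductSpace ComplexConjugate Matrix.Norms.L2Operator BigOperators Matrix

namespace Summit.QuantumFields.YangMills.Theorems.Prop7QkAdjointSupRowOfRegPr

open Literature.MathematicalPhysics.QuantumFieldTheory.Balaban1983to89
open Literature.MathematicalPhysics.QuantumFieldTheory.Balaban1983to89.T3ContinuumYM3Torus
open Finset
open T3SectALandauChart (eta eta_pos)
open T3PrintedRegularMinimiser (RegPr)
open B9SectCLatticeCarrier (Bond)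
open B9Eq311L2Pairing (WL2)
open B11Eq103H1Complex (BondL2K)
open Summit.QuantumFields.YangMills.Theorems.Prop7SectET3Transport (periodsT3 bondEquiv)
open Summit.QuantumFields.YangMills.Theorems.Prop7SectET3HilbertLetters (W₂ frobEquiv toL2 toL2B inner_toL2 inner_toL2B toL2_apply toL2_symm_apply
  toL2B_symm_apply inner_frobEquiv_symm)
open Summit.QuantumFields.YangMills.Theorems.Prop7SectET3CurvedPropagators (Qk)
open Summit.QuantumFields.YangMills.Theorems.Prop7SymAvgTwSym (QTwS)
open Summit.QuantumFields.YangMills.Theorems.Prop7TransverseRowOfTubeRowRegPr (Qk_toL2)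
open Summit.QuantumFields.YangMills.Theorems.Prop7DivSliceOfMemberDivSq (eta_sq_eq)
open Summit.QuantumFields.YangMills.Theorems.Prop7EngOfTrueAvgBudget (norm_toL2B_sq)
open Summit.QuantumFields.YangMills.Theorems.Prop7RieszTauFrobNorm (norm_le_norm_frobEquiv_symm norm_sq_frobEquiv_symm norm_frobEquiv_symm_le norm_frobEquiv_le)
open Summit.QuantumFields.YangMills.Theorems.Prop7QTwSEllTwoBound (sum_normSq_entries_QTwS_le)

variable (F : T3Family) {n K : ℕ} (h : n ≤ K) (c₀ cB : ℝ) [Fact (0 < c₀)] [Fact (0 < cB)]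

/-! ## §1 The adjoint of `Q_k(U₀)` read back on the route carriers is the weighted transpose of `QTwS U₀` -/

/-- ★ **THE DUALITY IDENTITY**: for every background `U₀`, block field `Y`, fine bond `b` and `X ∈ M₂(ℂ)`,
`⟪toL2(δ_b ⊗ X), Q_k(U₀)†(toL2B Y)⟫ = η·cB·Σ_c tr((QTwS U₀ (δ_b ⊗ X))(c)ᴴ·Y(c))` — `Q_k = η•toL2B∘QTwS∘toL2⁻¹` and the block pairing (3.16).
[cite: Balaban1985BackgroundPropagators, p.391, (3.16) p.393; Balaban1985Variational, (44)–(45) p.285] -/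
theorem inner_toL2_single_adjoint_Qk (U₀ : GaugeField (F.P K) 0 (Matrix.specialUnitaryGroup (Fin 2) ℂ))
    (Y : PBond (F.P n) 0 → Matrix (Fin 2) (Fin 2) ℂ) (b : PBond (F.P K) 0) (X : Matrix (Fin 2) (Fin 2) ℂ) :
    ⟪toL2 F K c₀ (Pi.single b X), LinearMap.adjoint (Qk F n K h c₀ cB U₀) (toL2B F n cB Y)⟫_ℂ
      = ((eta F n K * cB : ℝ) : ℂ) * ∑ c : PBond (F.P n) 0, Matrix.trace ((QTwS F n K h U₀ (Pi.single b X) c).conjTranspose * Y c) := by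
  rw [LinearMap.adjoint_inner_right, Qk_toL2, inner_smul_left, inner_toL2B, Complex.conj_ofReal, ← mul_assoc]
  push_cast
  ring

/-- The self-pairing of one bond: `⟪toL2(δ_b ⊗ Z(b)), toL2 Z⟫ = c₀·‖frobEquiv⁻¹(Z b)‖²` ((3.11) with a single summand). [cite: Balaban1985BackgroundPropagators, (3.11) p.392] -/
theorem inner_toL2_single_self (Z : PBond (F.P K) 0 → Matrix (Fin 2) (Fin 2) ℂ) (b : PBond (F.P K) 0) :
    ⟪toL2 F K c₀ (Pi.single b (Z b)), toL2 F K c₀ Z⟫_ℂ = ((c₀ * ‖(frobEquiv.symm (Z b) : W₂)‖ ^ 2 : ℝ) : ℂ) := by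
  classical
  rw [inner_toL2]
  have hsum : ∑ b' : PBond (F.P K) 0, Matrix.trace (((Pi.single b (Z b) : PBond (F.P K) 0 → Matrix (Fin 2) (Fin 2) ℂ) b').conjTranspose * Z b')
      = Matrix.trace ((Z b).conjTranspose * Z b) := by
    rw [Finset.sum_eq_single b]
    · rw [Pi.single_eq_same]
    · intro b' _ hb'
      rw [Pi.single_eq_of_ne hb', Matrix.conjTranspose_zero, Matrix.zero_mul, Matrix.trace_zero]
    · intro hb; exact absurd (Finset.mem_univ b) hb
  have h2 : Matrix.trace ((Z b).conjTranspose * Z b) = (((‖(frobEquiv.symm (Z b) : W₂)‖ ^ 2 : ℝ)) : ℂ) := by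
    rw [← inner_frobEquiv_symm, inner_self_eq_norm_sq_to_K]
    norm_cast
  rw [hsum, h2]
  push_cast
  ring

/-! ## §2 ★ The sup row of `Q_k(U₀)†` modulo the entrywise letter (COL) -/

/-- ★ **THE SUP ROW OF `Q_k(U₀)†` AT ANY BACKGROUND, FROM THE COLUMN `ℓ¹` LETTER OF `QTwS U₀`**: if every one-bond spike is spread by the averaging operator of record with
total mass `≤ C_Q·((L:ℝ)^(K−n))⁻²` (hypothesis `hcol` — FLAT: the tent count, `C_Q = 1`), then for every block field `Y` and fine bond `b`,
`‖toL2⁻¹(Q_k(U₀)†(toL2B Y))(b)‖ ≤ 2C_Q·(cB∕c₀)·((L:ℝ)^(K−n))⁻³·‖Y‖` — print's «`Q*` is a sup-norm contraction at the weights `c₀ = η³`, `cB = 1`», K-UNIFORM given (COL).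
Proof: test the adjoint against the spike `δ_b ⊗ Z(b)` (§1), Cauchy–Schwarz in the fibre, `|X| ≤ ‖X‖_F ≤ √2|X|` on `M₂(ℂ)`, and `η·ℓ⁻² = ℓ⁻³`.
[cite: Balaban1985BackgroundPropagators, (3.16) p.393, (3.42) p.397; Balaban1984PropagatorsI, (1.18) p.20] -/
theorem norm_toL2_symm_adjoint_Qk_apply_le_of_col (U₀ : GaugeField (F.P K) 0 (Matrix.specialUnitaryGroup (Fin 2) ℂ)) {CQ : ℝ} (hCQ : 0 ≤ CQ)
    (hcol : ∀ (b : PBond (F.P K) 0) (X : Matrix (Fin 2) (Fin 2) ℂ),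
      ∑ c : PBond (F.P n) 0, ‖QTwS F n K h U₀ (Pi.single b X) c‖ ≤ CQ * ((F.L : ℝ) ^ (K - n))⁻¹ ^ 2 * ‖X‖)
    (Y : PBond (F.P n) 0 → Matrix (Fin 2) (Fin 2) ℂ) (b : PBond (F.P K) 0) :
    ‖(toL2 F K c₀).symm (LinearMap.adjoint (Qk F n K h c₀ cB U₀) (toL2B F n cB Y)) b‖
      ≤ 2 * CQ * (cB / c₀) * ((F.L : ℝ) ^ (K - n))⁻¹ ^ 3 * ‖Y‖ := by
  have hc₀ : 0 < c₀ := Fact.out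
  have hcB : 0 < cB := Fact.out
  have hη : 0 < eta F n K := eta_pos F n K
  have hL0 : (0 : ℝ) < F.L := by exact_mod_cast lt_trans zero_lt_one F.hL.2
  have hℓ : (0 : ℝ) < (F.L : ℝ) ^ (K - n) := pow_pos hL0 _
  set Z : PBond (F.P K) 0 → Matrix (Fin 2) (Fin 2) ℂ := (toL2 F K c₀).symm (LinearMap.adjoint (Qk F n K h c₀ cB U₀) (toL2B F n cB Y)) with hZ
  have hZe : LinearMap.adjoint (Qk F n K h c₀ cB U₀) (toL2B F n cB Y) = toL2 F K c₀ Z := by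
    rw [hZ, LinearEquiv.apply_symm_apply]
  -- the norm of the fibre vector `v = frobEquiv⁻¹ (Z b)` controls `‖Z b‖`
  set v : W₂ := frobEquiv.symm (Z b) with hv
  have hZv : ‖Z b‖ ≤ ‖v‖ := norm_le_norm_frobEquiv_symm (Z b)
  -- the self-pairing and the transpose pairing are the same number
  have hself : ⟪toL2 F K c₀ (Pi.single b (Z b)), toL2 F K c₀ Z⟫_ℂ = ((c₀ * ‖v‖ ^ 2 : ℝ) : ℂ) := inner_toL2_single_self F c₀ Z b
  have hpair := inner_toL2_single_adjoint_Qk F h c₀ cB U₀ Y b (Z b)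
  rw [hZe, hself] at hpair
  -- bound the transpose pairing
  have hY0 : 0 ≤ ‖Y‖ := norm_nonneg _
  have htr : ∀ c : PBond (F.P n) 0, ‖Matrix.trace ((QTwS F n K h U₀ (Pi.single b (Z b)) c).conjTranspose * Y c)‖
      ≤ 2 * (‖QTwS F n K h U₀ (Pi.single b (Z b)) c‖ * ‖Y‖) := by
    intro c
    rw [← inner_frobEquiv_symm]
    calc ‖⟪(frobEquiv.symm (QTwS F n K h U₀ (Pi.single b (Z b)) c) : W₂), frobEquiv.symm (Y c)⟫_ℂ‖
        ≤ ‖(frobEquiv.symm (QTwS F n K h U₀ (Pi.single b (Z b)) c) : W₂)‖ * ‖(frobEquiv.symm (Y c) : W₂)‖ := norm_inner_le_norm _ _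
      _ ≤ (Real.sqrt 2 * ‖QTwS F n K h U₀ (Pi.single b (Z b)) c‖) * (Real.sqrt 2 * ‖Y c‖) :=
          mul_le_mul (norm_frobEquiv_symm_le _) (norm_frobEquiv_symm_le _) (norm_nonneg _) (by positivity)
      _ = 2 * (‖QTwS F n K h U₀ (Pi.single b (Z b)) c‖ * ‖Y c‖) := by
          have h2 : Real.sqrt 2 * Real.sqrt 2 = 2 := Real.mul_self_sqrt (by norm_num)
          linear_combination (‖QTwS F n K h U₀ (Pi.single b (Z b)) c‖ * ‖Y c‖) * h2
      _ ≤ 2 * (‖QTwS F n K h U₀ (Pi.single b (Z b)) c‖ * ‖Y‖) :=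
          mul_le_mul_of_nonneg_left (mul_le_mul_of_nonneg_left (norm_le_pi_norm Y c) (norm_nonneg _)) (by norm_num)
  have hsum : ‖∑ c : PBond (F.P n) 0, Matrix.trace ((QTwS F n K h U₀ (Pi.single b (Z b)) c).conjTranspose * Y c)‖
      ≤ 2 * ‖Y‖ * (CQ * ((F.L : ℝ) ^ (K - n))⁻¹ ^ 2 * ‖Z b‖) := by
    calc ‖∑ c : PBond (F.P n) 0, Matrix.trace ((QTwS F n K h U₀ (Pi.single b (Z b)) c).conjTranspose * Y c)‖
        ≤ ∑ c : PBond (F.P n) 0, ‖Matrix.trace ((QTwS F n K h U₀ (Pi.single b (Z b)) c).conjTranspose * Y c)‖ := norm_sum_le _ _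
      _ ≤ ∑ c : PBond (F.P n) 0, 2 * (‖QTwS F n K h U₀ (Pi.single b (Z b)) c‖ * ‖Y‖) := Finset.sum_le_sum fun c _ => htr c
      _ = 2 * ‖Y‖ * ∑ c : PBond (F.P n) 0, ‖QTwS F n K h U₀ (Pi.single b (Z b)) c‖ := by
          rw [Finset.mul_sum]; exact Finset.sum_congr rfl fun c _ => by ring
      _ ≤ 2 * ‖Y‖ * (CQ * ((F.L : ℝ) ^ (K - n))⁻¹ ^ 2 * ‖Z b‖) := mul_le_mul_of_nonneg_left (hcol b (Z b)) (by positivity)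
  -- the real inequality `c₀‖v‖² ≤ η·cB·2‖Y‖·C_Q·ℓ⁻²·‖v‖`
  have hkey : c₀ * ‖v‖ ^ 2 ≤ eta F n K * cB * (2 * ‖Y‖ * (CQ * ((F.L : ℝ) ^ (K - n))⁻¹ ^ 2 * ‖v‖)) := by
    have h1 : ‖(((c₀ * ‖v‖ ^ 2 : ℝ)) : ℂ)‖ = c₀ * ‖v‖ ^ 2 := by
      rw [Complex.norm_real, Real.norm_of_nonneg (by positivity)]
    rw [← h1, hpair, norm_mul, Complex.norm_real, Real.norm_of_nonneg (by positivity)]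
    refine mul_le_mul_of_nonneg_left (hsum.trans ?_) (by positivity)
    exact mul_le_mul_of_nonneg_left (mul_le_mul_of_nonneg_left hZv (by positivity)) (by positivity)
  -- divide by `‖v‖` (the case `v = 0` is trivial)
  have hgoal : ‖v‖ ≤ 2 * CQ * (cB / c₀) * ((F.L : ℝ) ^ (K - n))⁻¹ ^ 3 * ‖Y‖ := by
    have hηℓ : eta F n K * ((F.L : ℝ) ^ (K - n))⁻¹ ^ 2 = ((F.L : ℝ) ^ (K - n))⁻¹ ^ 3 := by
      rw [eta, inv_pow]; ring
    by_cases hv0 : ‖v‖ = 0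
    · rw [hv0]; positivity
    · have hvpos : 0 < ‖v‖ := lt_of_le_of_ne (norm_nonneg _) (Ne.symm hv0)
      have h2 : c₀ * ‖v‖ ≤ eta F n K * cB * (2 * ‖Y‖ * (CQ * ((F.L : ℝ) ^ (K - n))⁻¹ ^ 2)) := by
        have := hkey
        rw [pow_two, ← mul_assoc] at this
        have e : eta F n K * cB * (2 * ‖Y‖ * (CQ * ((F.L : ℝ) ^ (K - n))⁻¹ ^ 2 * ‖v‖))
            = (eta F n K * cB * (2 * ‖Y‖ * (CQ * ((F.L : ℝ) ^ (K - n))⁻¹ ^ 2))) * ‖v‖ := by ring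
        rw [e] at this
        exact le_of_mul_le_mul_right this hvpos
      rw [← hηℓ]
      calc ‖v‖ = c₀ * ‖v‖ / c₀ := by field_simp
        _ ≤ eta F n K * cB * (2 * ‖Y‖ * (CQ * ((F.L : ℝ) ^ (K - n))⁻¹ ^ 2)) / c₀ := div_le_div_of_nonneg_right h2 hc₀.le
        _ = 2 * CQ * (cB / c₀) * (eta F n K * ((F.L : ℝ) ^ (K - n))⁻¹ ^ 2) * ‖Y‖ := by
            field_simp
  exact hZv.trans hgoal

/-! ## §3 The `ℓ²` operator bound of `Q_k(U₀)` at a printed-regular background -/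

/-- **`‖Q_k(U₀)u‖ ≤ 6·√(cB∕c₀)·√(((L:ℝ)^(K−n))⁻³)·‖u‖`** for `RegPr F n K ε₀ U₀` under the windows `10¹⁰L⁶ε₀ ≤ 1`, `10¹²L³ε₀ ≤ 1` — ✓`sum_normSq_entries_QTwS_le`
(`36·ℓ²∕ℓ^d` in Hilbert–Schmidt entries) read through `Q_k = η•toL2B∘QTwS∘toL2⁻¹`, `η² = ℓ⁻²`, `d = 3`. [cite: Balaban1985BackgroundPropagators, (3.13)–(3.16) p.393, Thm 3.11 p.416] -/
theorem norm_Qk_le_of_regPr {ε₀ : ℝ} (hε₀ : 0 < ε₀) (hε : 10 ^ 10 * (F.L : ℝ) ^ 6 * ε₀ ≤ 1) (hε12 : 10 ^ 12 * (F.L : ℝ) ^ 3 * ε₀ ≤ 1)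
    (U₀ : GaugeField (F.P K) 0 (Matrix.specialUnitaryGroup (Fin 2) ℂ)) (hreg : RegPr F n K ε₀ U₀) (u : BondL2K ℂ 3 (periodsT3 F K) c₀ W₂) :
    ‖Qk F n K h c₀ cB U₀ u‖ ≤ 6 * Real.sqrt (cB / c₀) * Real.sqrt (((F.L : ℝ) ^ (K - n))⁻¹ ^ 3) * ‖u‖ := by
  have hc₀ : 0 < c₀ := Fact.out
  have hcB : 0 < cB := Fact.out
  have hη : 0 < eta F n K := eta_pos F n K
  have hL0 : (0 : ℝ) < F.L := by exact_mod_cast lt_trans zero_lt_one F.hL.2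
  have hℓ : (0 : ℝ) < (F.L : ℝ) ^ (K - n) := pow_pos hL0 _
  obtain ⟨X, rfl⟩ : ∃ X, u = toL2 F K c₀ X := ⟨(toL2 F K c₀).symm u, ((toL2 F K c₀).apply_symm_apply u).symm⟩
  have hd : (F.P K).d = 3 := rfl
  -- `‖Q_k(U₀)(toL2 X)‖² = η²·cB·Σ_c Σ_jk |(QTwS X c)_jk|²`
  have hQ : ‖Qk F n K h c₀ cB U₀ (toL2 F K c₀ X)‖ ^ 2
      = eta F n K ^ 2 * (cB * ∑ c : PBond (F.P n) 0, ∑ j, ∑ k, ‖QTwS F n K h U₀ X c j k‖ ^ 2) := by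
    rw [Qk_toL2, norm_smul, mul_pow, Complex.norm_real, Real.norm_of_nonneg hη.le, norm_toL2B_sq]
    congr 2
    exact Finset.sum_congr rfl fun c _ => norm_sq_frobEquiv_symm _
  -- `‖toL2 X‖² = c₀·Σ_b Σ_jk |X b jk|²`
  have hX : ‖toL2 F K c₀ X‖ ^ 2 = c₀ * ∑ b : PBond (F.P K) 0, ∑ j, ∑ k, ‖X b j k‖ ^ 2 := by
    have h2 : ∀ b : PBond (F.P K) 0, Matrix.trace ((X b).conjTranspose * X b) = (((‖(frobEquiv.symm (X b) : W₂)‖ ^ 2 : ℝ)) : ℂ) := by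
      intro b
      rw [← inner_frobEquiv_symm, inner_self_eq_norm_sq_to_K]
      norm_cast
    rw [@norm_sq_eq_re_inner ℂ, inner_toL2]
    simp_rw [h2]
    rw [← Complex.ofReal_sum, ← Complex.ofReal_mul, RCLike.re_to_complex, Complex.ofReal_re]
    congr 1
    exact Finset.sum_congr rfl fun b _ => norm_sq_frobEquiv_symm _
  have hS := sum_normSq_entries_QTwS_le F n K h hε₀ hε hε12 U₀ hreg X
  rw [hd] at hS
  -- assemble the squares
  have hsq : ‖Qk F n K h c₀ cB U₀ (toL2 F K c₀ X)‖ ^ 2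
      ≤ (6 * Real.sqrt (cB / c₀) * Real.sqrt (((F.L : ℝ) ^ (K - n))⁻¹ ^ 3) * ‖toL2 F K c₀ X‖) ^ 2 := by
    have hS0 : 0 ≤ ∑ b : PBond (F.P K) 0, ∑ j, ∑ k, ‖X b j k‖ ^ 2 := by positivity
    rw [hQ, mul_pow, mul_pow, mul_pow, Real.sq_sqrt (div_nonneg hcB.le hc₀.le), Real.sq_sqrt (by positivity), hX, eta_sq_eq]
    calc (((F.L : ℝ) ^ (K - n)) ^ 2)⁻¹ * (cB * ∑ c : PBond (F.P n) 0, ∑ j, ∑ k, ‖QTwS F n K h U₀ X c j k‖ ^ 2)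
        ≤ (((F.L : ℝ) ^ (K - n)) ^ 2)⁻¹ * (cB * (36 * (((F.L : ℝ) ^ (K - n)) ^ 2 / ((F.L : ℝ) ^ (K - n)) ^ 3) *
            ∑ b : PBond (F.P K) 0, ∑ j, ∑ k, ‖X b j k‖ ^ 2)) :=
          mul_le_mul_of_nonneg_left (mul_le_mul_of_nonneg_left hS hcB.le) (by positivity)
      _ = 6 ^ 2 * (cB / c₀) * ((F.L : ℝ) ^ (K - n))⁻¹ ^ 3 * (c₀ * ∑ b : PBond (F.P K) 0, ∑ j, ∑ k, ‖X b j k‖ ^ 2) := by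
          field_simp
          ring
  have hR0 : 0 ≤ 6 * Real.sqrt (cB / c₀) * Real.sqrt (((F.L : ℝ) ^ (K - n))⁻¹ ^ 3) * ‖toL2 F K c₀ X‖ := by positivity
  exact (pow_le_pow_iff_left₀ (norm_nonneg _) hR0 two_ne_zero).mp hsq

/-! ## §4 ★★ The (Q) letter of the one-form Kato bootstrap: the pointwise row of `Q_k(U₀)†(a•Q_k(U₀)u)` -/

/-- Every block entry of `Q_k(U₀)u` is controlled by the `L²` norm: `‖(Q_k(U₀)u)(c)‖_{W₂} ≤ ‖Q_k(U₀)u‖∕√cB` (one summand of the `cB`-weighted sum (3.16)).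
[cite: Balaban1985BackgroundPropagators, (3.16) p.393] -/
theorem norm_equiv_apply_le_norm_div_sqrt (g : WL2 ℂ (fun _ : PBond (F.P n) 0 => cB) W₂) (c : PBond (F.P n) 0) :
    ‖WL2.equiv ℂ (fun _ : PBond (F.P n) 0 => cB) W₂ g c‖ ≤ ‖g‖ / Real.sqrt cB := by
  have hcB : 0 < cB := Fact.out
  have hs : 0 < Real.sqrt cB := Real.sqrt_pos.2 hcB
  rw [le_div_iff₀ hs]
  have h := WL2.weight_mul_norm_sq_apply_le (𝕜 := ℂ) (w := fun _ : PBond (F.P n) 0 => cB) (V := W₂) g c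
  have h' : (‖WL2.equiv ℂ (fun _ : PBond (F.P n) 0 => cB) W₂ g c‖ * Real.sqrt cB) ^ 2 ≤ ‖g‖ ^ 2 := by
    rw [mul_pow, Real.sq_sqrt hcB.le, mul_comm]; exact h
  exact (pow_le_pow_iff_left₀ (by positivity) (norm_nonneg _) two_ne_zero).mp h'

/-- ★★ **THE (Q) LETTER OF O2, MODULO (COL) AND AN OPERATOR BOUND `N_Q` OF `Q_k(U₀)`**: for `0 ≤ a`, every vector field `u` and every lit-balaban bond `p`,
`‖(Q_k(U₀)†((a:ℂ)•Q_k(U₀)u))(p)‖_{W₂} ≤ a·(√2·(2C_Q·(cB∕c₀)·((L:ℝ)^(K−n))⁻³))·(N_Q∕√cB)·‖u‖` — §2 on the block field `Y := toL2B⁻¹(Q_k(U₀)u)` (`‖Y‖_∞ ≤ N_Q‖u‖∕√cB` by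
`norm_equiv_apply_le_norm_div_sqrt`), read in the fibre through `toL2` (`‖·‖_{W₂} ≤ √2·|·|`). [cite: Balaban1985BackgroundPropagators, (3.26) p.395, (3.42) p.397; Balaban1985Variational, (137) p.298, (138)–(139) p.299] -/
theorem norm_equiv_adjoint_Qk_smul_Qk_apply_le_of_col (U₀ : GaugeField (F.P K) 0 (Matrix.specialUnitaryGroup (Fin 2) ℂ)) {CQ : ℝ} (hCQ : 0 ≤ CQ)
    (hcol : ∀ (b : PBond (F.P K) 0) (X : Matrix (Fin 2) (Fin 2) ℂ),
      ∑ c : PBond (F.P n) 0, ‖QTwS F n K h U₀ (Pi.single b X) c‖ ≤ CQ * ((F.L : ℝ) ^ (K - n))⁻¹ ^ 2 * ‖X‖)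
    {NQ : ℝ} (hNQ : 0 ≤ NQ) (hQk : ∀ u : BondL2K ℂ 3 (periodsT3 F K) c₀ W₂, ‖Qk F n K h c₀ cB U₀ u‖ ≤ NQ * ‖u‖)
    {a : ℝ} (ha : 0 ≤ a) (u : BondL2K ℂ 3 (periodsT3 F K) c₀ W₂) (p : Bond 3 (periodsT3 F K)) :
    ‖WL2.equiv ℂ (fun _ : Bond 3 (periodsT3 F K) => c₀) W₂ (LinearMap.adjoint (Qk F n K h c₀ cB U₀) (((a : ℝ) : ℂ) • Qk F n K h c₀ cB U₀ u)) p‖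
      ≤ a * (Real.sqrt 2 * (2 * CQ * (cB / c₀) * ((F.L : ℝ) ^ (K - n))⁻¹ ^ 3)) * (NQ / Real.sqrt cB) * ‖u‖ := by
  have hc₀ : 0 < c₀ := Fact.out
  have hcB : 0 < cB := Fact.out
  have hL0 : (0 : ℝ) < F.L := by exact_mod_cast lt_trans zero_lt_one F.hL.2
  have hℓ : (0 : ℝ) < (F.L : ℝ) ^ (K - n) := pow_pos hL0 _
  -- the block field `Y` with `toL2B Y = Q_k(U₀)u`
  obtain ⟨Y, hYe⟩ : ∃ Y : PBond (F.P n) 0 → Matrix (Fin 2) (Fin 2) ℂ, Qk F n K h c₀ cB U₀ u = toL2B F n cB Y :=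
    ⟨(toL2B F n cB).symm (Qk F n K h c₀ cB U₀ u), ((toL2B F n cB).apply_symm_apply _).symm⟩
  have hYdef : Y = (toL2B F n cB).symm (Qk F n K h c₀ cB U₀ u) := by rw [hYe, LinearEquiv.symm_apply_apply]
  have hYn : ‖Y‖ ≤ NQ / Real.sqrt cB * ‖u‖ := by
    refine (pi_norm_le_iff_of_nonneg (by positivity)).2 fun c => ?_
    rw [hYdef, toL2B_symm_apply]
    calc ‖frobEquiv (WL2.equiv ℂ (fun _ : PBond (F.P n) 0 => cB) W₂ (Qk F n K h c₀ cB U₀ u) c)‖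
        ≤ ‖WL2.equiv ℂ (fun _ : PBond (F.P n) 0 => cB) W₂ (Qk F n K h c₀ cB U₀ u) c‖ := norm_frobEquiv_le _
      _ ≤ ‖Qk F n K h c₀ cB U₀ u‖ / Real.sqrt cB := norm_equiv_apply_le_norm_div_sqrt F cB _ c
      _ ≤ NQ * ‖u‖ / Real.sqrt cB := div_le_div_of_nonneg_right (hQk u) (Real.sqrt_nonneg _)
      _ = NQ / Real.sqrt cB * ‖u‖ := by ring
  -- the readback `Z` of the adjoint and its sup row (§2)
  obtain ⟨Z, hZ⟩ : ∃ Z : PBond (F.P K) 0 → Matrix (Fin 2) (Fin 2) ℂ,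
      Z = (toL2 F K c₀).symm (LinearMap.adjoint (Qk F n K h c₀ cB U₀) (toL2B F n cB Y)) := ⟨_, rfl⟩
  have hZe : LinearMap.adjoint (Qk F n K h c₀ cB U₀) (toL2B F n cB Y) = toL2 F K c₀ Z := by rw [hZ, LinearEquiv.apply_symm_apply]
  have hZb : ∀ b, ‖Z b‖ ≤ 2 * CQ * (cB / c₀) * ((F.L : ℝ) ^ (K - n))⁻¹ ^ 3 * ‖Y‖ :=
    fun b => hZ ▸ norm_toL2_symm_adjoint_Qk_apply_le_of_col F h c₀ cB U₀ hCQ hcol Y b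
  -- the scalar `a` and the fibre reading at `p`
  rw [LinearMap.map_smul, WL2.equiv_smul, Pi.smul_apply, norm_smul, Complex.norm_real, Real.norm_of_nonneg ha, hYe, hZe, toL2_apply]
  have hK0 : 0 ≤ Real.sqrt 2 * (2 * CQ * (cB / c₀) * ((F.L : ℝ) ^ (K - n))⁻¹ ^ 3) := by positivity
  calc a * ‖(frobEquiv.symm (Z ((bondEquiv F K).symm p)) : W₂)‖
      ≤ a * (Real.sqrt 2 * ‖Z ((bondEquiv F K).symm p)‖) := mul_le_mul_of_nonneg_left (norm_frobEquiv_symm_le _) ha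
    _ ≤ a * (Real.sqrt 2 * (2 * CQ * (cB / c₀) * ((F.L : ℝ) ^ (K - n))⁻¹ ^ 3 * ‖Y‖)) :=
        mul_le_mul_of_nonneg_left (mul_le_mul_of_nonneg_left (hZb _) (Real.sqrt_nonneg _)) ha
    _ = a * (Real.sqrt 2 * (2 * CQ * (cB / c₀) * ((F.L : ℝ) ^ (K - n))⁻¹ ^ 3)) * ‖Y‖ := by ring
    _ ≤ a * (Real.sqrt 2 * (2 * CQ * (cB / c₀) * ((F.L : ℝ) ^ (K - n))⁻¹ ^ 3)) * (NQ / Real.sqrt cB * ‖u‖) :=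
        mul_le_mul_of_nonneg_left hYn (mul_nonneg ha hK0)
    _ = a * (Real.sqrt 2 * (2 * CQ * (cB / c₀) * ((F.L : ℝ) ^ (K - n))⁻¹ ^ 3)) * (NQ / Real.sqrt cB) * ‖u‖ := by ring

/-- ★★ **THE (Q) LETTER OF O2 AT A PRINTED-REGULAR BACKGROUND, MODULO (COL) ALONE**: §4 with `N_Q := 6√(cB∕c₀)√(((L:ℝ)^(K−n))⁻³)` from §3 — at the pins of record
(`a = a₀(c₀∕cB)ℓ³`, `cB = c₀ℓ³`) every `ℓ = L^{K−n}` cancels once the remaining `√(c₀ℓ³)`-normalisation of the fibre reading is inserted (LOCATE §3), as the chair's WORD №4 (B) states.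
[cite: Balaban1985BackgroundPropagators, (3.26) p.395, (3.42) p.397, Thm 3.11 p.416; Balaban1985Variational, (137) p.298, (138)–(139) p.299] -/
theorem norm_equiv_adjoint_Qk_smul_Qk_apply_le_of_col_of_regPr {ε₀ : ℝ} (hε₀ : 0 < ε₀) (hε : 10 ^ 10 * (F.L : ℝ) ^ 6 * ε₀ ≤ 1)
    (hε12 : 10 ^ 12 * (F.L : ℝ) ^ 3 * ε₀ ≤ 1)
    (U₀ : GaugeField (F.P K) 0 (Matrix.specialUnitaryGroup (Fin 2) ℂ)) (hreg : RegPr F n K ε₀ U₀) {CQ : ℝ} (hCQ : 0 ≤ CQ)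
    (hcol : ∀ (b : PBond (F.P K) 0) (X : Matrix (Fin 2) (Fin 2) ℂ),
      ∑ c : PBond (F.P n) 0, ‖QTwS F n K h U₀ (Pi.single b X) c‖ ≤ CQ * ((F.L : ℝ) ^ (K - n))⁻¹ ^ 2 * ‖X‖)
    {a : ℝ} (ha : 0 ≤ a) (u : BondL2K ℂ 3 (periodsT3 F K) c₀ W₂) (p : Bond 3 (periodsT3 F K)) :
    ‖WL2.equiv ℂ (fun _ : Bond 3 (periodsT3 F K) => c₀) W₂ (LinearMap.adjoint (Qk F n K h c₀ cB U₀) (((a : ℝ) : ℂ) • Qk F n K h c₀ cB U₀ u)) p‖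
      ≤ a * (Real.sqrt 2 * (2 * CQ * (cB / c₀) * ((F.L : ℝ) ^ (K - n))⁻¹ ^ 3))
          * (6 * Real.sqrt (cB / c₀) * Real.sqrt (((F.L : ℝ) ^ (K - n))⁻¹ ^ 3) / Real.sqrt cB) * ‖u‖ :=
  norm_equiv_adjoint_Qk_smul_Qk_apply_le_of_col F h c₀ cB U₀ hCQ hcol (by positivity)
    (fun v => norm_Qk_le_of_regPr F h c₀ cB hε₀ hε hε12 U₀ hreg v) ha u p

end Summit.QuantumFields.YangMills.Theorems.Prop7QkAdjointSupRowOfRegPr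

end
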